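import Summits.RiemannHypothesis.RiemannHypothesis.Theorems.GroundBartaPolarPerronFrobeniusSourceCofinal
import Summits.RiemannHypothesis.RiemannHypothesis.Theorems.GroundBartaPolarPerronFrobeniusEvenPolarGain
import HarnessLib

/-!
# RiemannHypothesis / GroundBarta — crux `PolarPerronFrobenius` (stmt-RiemannHypothesis-18390):
# KERNEL CRITERIA from the source criterion (numerics-free thresholds)

Helper file (`--supports stmt-RiemannHypothesis-18390`), RH-free, Mathlib + proved tree files only,
no definitions, no named facts.

The source criterion (`…SourceCriterion.lean`) reduces cone density at a window `a` to the sign of the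
source `S_f(y) = ∫f⁺(x)w(|x−y|)dx + Σ_{log n<2a}Λ(n)n^{-1/2}(f⁺(y±log n)) − 2∫f⁺(x)cosh((x−y)/2)dx` on the
negative set of real near-minimisers `f`.  Two POINTWISE kernel hypotheses make `S_f ≥ 0` for EVERY real
(resp. every even real) window test, with no numerics:

* `swu_source_nonneg_of_kernel`: if `2cosh(s/2) ≤ w(s)` for `0 < s ≤ 2a` (true iff `a ≤ 0.1406…`),
  then `S_f(y) ≥ 0` at every `y` with `f(y) < 0`, for every real test `f` on `[-a, a]`; hence
  `swu_coneDense_of_kernel`: cone density at `a` (parity-free) — the small-window theorem of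
  `…SmallWindows.lean` (`a ≤ 1/10`) with its SHARP hypothesis isolated;
* `swu_source_nonneg_of_kernel_even`: if `2cosh(s/2) + 2cosh(t/2) ≤ w(s) + w(t)` for `0 < s, t`,
  `s + t ≤ 2a` (true iff `a ≤ 0.2812…`), then `S_f ≥ 0` on `{f < 0}` for every EVEN real test; hence
  `swu_evenConeDense_of_kernel_even`: the S1 matrix at `a` — the even theorem of `…EvenSmallWindows.lean`
  (`a ≤ 1/4`) with its sharp hypothesis isolated (and the kernel untruncated).

Prover B, speedrun unit `sr-gb-rung-b` (seat 2).
-/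

set_option linter.dupNamespace false

noncomputable section

open Set MeasureTheory Filter Complex
open scoped Real Topology

namespace Summit.RiemannHypothesis.RiemannHypothesis.Theorems.PolarPerronFrobenius

open Literature.NumberTheory.LFunctions
open Summit.RiemannHypothesis.RiemannHypothesis.Theorems.OddSector
open scoped ArithmeticFunction.vonMangoldt

section Source

variable {f : ℝ → ℝ} {a : ℝ}

/-- At `y` with `f(y) < 0`: `x ↦ f⁺(x) w(|x−y|)` is integrable (bounded by `L²ae^{a}/f⁻(y)`, supported
in `[-a, a]`). [folklore] -/
theorem swu_integrable_posPart_mul_kernel (hf : ContDiff ℝ (⊤ : ℕ∞) f) (hfs : HasCompactSupport f)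
    (ha : 0 < a) (hsupp : Function.support f ⊆ Icc (-a) a) {y : ℝ} (hy : f y < 0) :
    Integrable fun x ↦ max (f x) 0 * weilArchDensity |x - y| := by
  have hfc : Continuous f := hf.continuous
  have hp : Continuous fun x ↦ max (f x) 0 := hfc.max continuous_const
  obtain ⟨L, hL0, hL⟩ := swu_exists_lipschitz hf hfs
  have hmeas : AEStronglyMeasurable (fun x ↦ max (f x) 0 * weilArchDensity |x - y|) volume :=
    (hp.measurable.mul (swu_measurable_kernel.comp (measurable_id.sub measurable_const))).aestronglyMeasurable
  refine Integrable.mono' ((integrable_indicator_iff measurableSet_Icc).2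
    (integrableOn_const (by simp) :
      IntegrableOn (fun _ ↦ L ^ 2 * (a * Real.exp a) / max (-f y) 0) (Icc (-a) a))) hmeas
    (Eventually.of_forall fun x ↦ ?_)
  have h0 : 0 ≤ max (f x) 0 * weilArchDensity |x - y| :=
    mul_nonneg (le_max_right _ _) (GroundBartaFloor.weilArchDensity_abs_nonneg _)
  rw [Real.norm_of_nonneg h0]
  by_cases hx : x ∈ Icc (-a) a
  · rw [Set.indicator_of_mem hx, mul_comm, abs_sub_comm]
    exact swu_kernel_posPart_le hfc hL0 hL ha hsupp hy x
  · have hfx : f x = 0 := by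
      by_contra hne; exact hx (hsupp (Function.mem_support.2 hne))
    rw [hfx, max_self, zero_mul, Set.indicator_of_notMem hx]

/-- The prime part of the source is non-negative. [folklore] -/
theorem swu_primeSource_nonneg (f : ℝ → ℝ) (a y : ℝ) :
    0 ≤ ∑ n ∈ weilPrimeIndex a, (Λ n : ℝ) / Real.sqrt n *
      (max (f (y + Real.log n)) 0 + max (f (y - Real.log n)) 0) :=
  Finset.sum_nonneg fun _ _ ↦ mul_nonneg
    (div_nonneg ArithmeticFunction.vonMangoldt_nonneg (Real.sqrt_nonneg _))
    (add_nonneg (le_max_right _ _) (le_max_right _ _))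

/-- **Parity-free kernel hypothesis ⇒ non-negative source.**  If `2cosh(s/2) ≤ w(s)` for all
`0 < s ≤ 2a`, then `S_f(y) ≥ 0` at every `y` with `f(y) < 0`, for every real smooth `f` supported in
`[-a, a]`. [folklore] -/
theorem swu_source_nonneg_of_kernel (hf : ContDiff ℝ (⊤ : ℕ∞) f) (hfs : HasCompactSupport f)
    (ha : 0 < a) (hsupp : Function.support f ⊆ Icc (-a) a)
    (hker : ∀ s : ℝ, 0 < s → s ≤ 2 * a → 2 * Real.cosh (s / 2) ≤ weilArchDensity s)
    {y : ℝ} (hy : f y < 0) :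
    0 ≤ (∫ x, max (f x) 0 * weilArchDensity |x - y|) +
      (∑ n ∈ weilPrimeIndex a, (Λ n : ℝ) / Real.sqrt n *
        (max (f (y + Real.log n)) 0 + max (f (y - Real.log n)) 0)) -
      2 * ∫ x, max (f x) 0 * Real.cosh ((x - y) / 2) := by
  have hfc : Continuous f := hf.continuous
  have hcosh : Continuous fun x : ℝ ↦ Real.cosh ((x - y) / 2) :=
    Real.continuous_cosh.comp ((continuous_id.sub continuous_const).div_const 2)
  have i1 := swu_integrable_posPart_mul_kernel hf hfs ha hsupp hy
  have i2 : Integrable fun x ↦ max (f x) 0 * Real.cosh ((x - y) / 2) :=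
    sw_integrable_posPart_mul hfc hfs hcosh
  have hya : |y| ≤ a := by
    have hm := hsupp (Function.mem_support.2 hy.ne)
    exact abs_le.2 ⟨hm.1, hm.2⟩
  have hmain : 0 ≤ ∫ x, (max (f x) 0 * weilArchDensity |x - y| - 2 * (max (f x) 0 * Real.cosh ((x - y) / 2))) := by
    refine integral_nonneg fun x ↦ ?_
    simp only [Pi.zero_apply]
    rcases eq_or_lt_of_le (le_max_right (f x) 0) with h0 | hpos
    · rw [← h0]; simp
    · have hfx : 0 < f x := by
        rcases lt_or_ge 0 (f x) with h | h
        · exact h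
        · rw [max_eq_right h] at hpos; exact absurd hpos (lt_irrefl 0)
      have hxa : |x| ≤ a := by
        have hm := hsupp (Function.mem_support.2 hfx.ne')
        exact abs_le.2 ⟨hm.1, hm.2⟩
      have hxy : x ≠ y := fun h ↦ by rw [h] at hfx; linarith
      have hs : 0 < |x - y| := abs_pos.2 (sub_ne_zero.2 hxy)
      have hs2 : |x - y| ≤ 2 * a := by
        rw [abs_le]; constructor <;> linarith [(abs_le.1 hxa).1, (abs_le.1 hxa).2,
          (abs_le.1 hya).1, (abs_le.1 hya).2]
      have hk := hker _ hs hs2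
      have e : Real.cosh (|x - y| / 2) = Real.cosh ((x - y) / 2) := by
        rw [show |x - y| / 2 = |(x - y) / 2| by rw [abs_div, abs_two], Real.cosh_abs]
      rw [e] at hk
      nlinarith [hpos.le]
  rw [integral_sub i1 (i2.const_mul 2), integral_const_mul] at hmain
  linarith [swu_primeSource_nonneg f a y]

/-- **Even kernel hypothesis ⇒ non-negative source for even `f`.**  If
`2cosh(s/2) + 2cosh(t/2) ≤ w(s) + w(t)` whenever `0 < s`, `0 < t`, `s + t ≤ 2a`, then `S_f(y) ≥ 0` at
every `y` with `f(y) < 0`, for every EVEN real smooth `f` supported in `[-a, a]` (reflect `x ↦ −x` in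
both integrals and average: the integrand becomes `½f⁺(x)[w(|x−y|) + w(|x+y|) − 2cosh((x−y)/2) −
2cosh((x+y)/2)] ≥ 0`). [folklore] -/
theorem swu_source_nonneg_of_kernel_even (hf : ContDiff ℝ (⊤ : ℕ∞) f) (hfs : HasCompactSupport f)
    (ha : 0 < a) (hsupp : Function.support f ⊆ Icc (-a) a) (hfe : ∀ t, f (-t) = f t)
    (hker : ∀ s t : ℝ, 0 < s → 0 < t → s + t ≤ 2 * a →
      2 * Real.cosh (s / 2) + 2 * Real.cosh (t / 2) ≤ weilArchDensity s + weilArchDensity t)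
    {y : ℝ} (hy : f y < 0) :
    0 ≤ (∫ x, max (f x) 0 * weilArchDensity |x - y|) +
      (∑ n ∈ weilPrimeIndex a, (Λ n : ℝ) / Real.sqrt n *
        (max (f (y + Real.log n)) 0 + max (f (y - Real.log n)) 0)) -
      2 * ∫ x, max (f x) 0 * Real.cosh ((x - y) / 2) := by
  have hfc : Continuous f := hf.continuous
  have hy' : f (-y) < 0 := by rwa [hfe]
  have hcosh : ∀ z : ℝ, Continuous fun x : ℝ ↦ Real.cosh ((x - z) / 2) := fun z ↦
    Real.continuous_cosh.comp ((continuous_id.sub continuous_const).div_const 2)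
  have i1 := swu_integrable_posPart_mul_kernel hf hfs ha hsupp hy
  have i1' : Integrable fun x ↦ max (f x) 0 * weilArchDensity |x + y| := by
    refine (swu_integrable_posPart_mul_kernel hf hfs ha hsupp hy').congr
      (Eventually.of_forall fun x ↦ ?_)
    simp only; rw [sub_neg_eq_add]
  have i2 : Integrable fun x ↦ max (f x) 0 * Real.cosh ((x - y) / 2) :=
    sw_integrable_posPart_mul hfc hfs (hcosh y)
  have i2' : Integrable fun x ↦ max (f x) 0 * Real.cosh ((x + y) / 2) := by
    refine (sw_integrable_posPart_mul hfc hfs (hcosh (-y))).congr (Eventually.of_forall fun x ↦ ?_)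
    simp only; rw [sub_neg_eq_add]
  -- reflection `x ↦ -x` (`f⁺` even)
  have r1 : ∫ x, max (f x) 0 * weilArchDensity |x - y| = ∫ x, max (f x) 0 * weilArchDensity |x + y| := by
    rw [← integral_neg_eq_self (fun x ↦ max (f x) 0 * weilArchDensity |x - y|) volume]
    refine integral_congr_ae (Eventually.of_forall fun x ↦ ?_)
    simp only
    rw [hfe, show -x - y = -(x + y) by ring, abs_neg]
  have r2 : ∫ x, max (f x) 0 * Real.cosh ((x - y) / 2) = ∫ x, max (f x) 0 * Real.cosh ((x + y) / 2) := by
    rw [← integral_neg_eq_self (fun x ↦ max (f x) 0 * Real.cosh ((x - y) / 2)) volume]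
    refine integral_congr_ae (Eventually.of_forall fun x ↦ ?_)
    simp only
    rw [hfe, show (-x - y) / 2 = -((x + y) / 2) by ring, Real.cosh_neg]
  have hya : |y| ≤ a := by
    have hm := hsupp (Function.mem_support.2 hy.ne)
    exact abs_le.2 ⟨hm.1, hm.2⟩
  -- the symmetrised integrand is non-negative
  have hmain : 0 ≤ ∫ x, (max (f x) 0 * weilArchDensity |x - y| + max (f x) 0 * weilArchDensity |x + y| -
      2 * (max (f x) 0 * Real.cosh ((x - y) / 2)) - 2 * (max (f x) 0 * Real.cosh ((x + y) / 2))) := by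
    refine integral_nonneg fun x ↦ ?_
    simp only [Pi.zero_apply]
    rcases eq_or_lt_of_le (le_max_right (f x) 0) with h0 | hpos
    · rw [← h0]; simp
    · have hfx : 0 < f x := by
        rcases lt_or_ge 0 (f x) with h | h
        · exact h
        · rw [max_eq_right h] at hpos; exact absurd hpos (lt_irrefl 0)
      have hxa : |x| ≤ a := by
        have hm := hsupp (Function.mem_support.2 hfx.ne')
        exact abs_le.2 ⟨hm.1, hm.2⟩
      have hxy : x ≠ y := fun h ↦ by rw [h] at hfx; linarith
      have hxy' : x ≠ -y := fun h ↦ by rw [h] at hfx; linarith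
      have hs : 0 < |x - y| := abs_pos.2 (sub_ne_zero.2 hxy)
      have ht : 0 < |x + y| := abs_pos.2 fun h ↦ hxy' (by linarith)
      have hst := swe_abs_sub_add_abs_add_le hxa hya
      have hk := hker _ _ hs ht hst
      have e1 : Real.cosh (|x - y| / 2) = Real.cosh ((x - y) / 2) := by
        rw [show |x - y| / 2 = |(x - y) / 2| by rw [abs_div, abs_two], Real.cosh_abs]
      have e2 : Real.cosh (|x + y| / 2) = Real.cosh ((x + y) / 2) := by
        rw [show |x + y| / 2 = |(x + y) / 2| by rw [abs_div, abs_two], Real.cosh_abs]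
      rw [e1, e2] at hk
      nlinarith [hpos.le]
  have iA : Integrable (fun x ↦ max (f x) 0 * weilArchDensity |x - y| +
      max (f x) 0 * weilArchDensity |x + y|) := i1.add i1'
  have i2c : Integrable (fun x ↦ 2 * (max (f x) 0 * Real.cosh ((x - y) / 2))) := i2.const_mul 2
  have iB : Integrable (fun x ↦ max (f x) 0 * weilArchDensity |x - y| +
      max (f x) 0 * weilArchDensity |x + y| - 2 * (max (f x) 0 * Real.cosh ((x - y) / 2))) := iA.sub i2c
  have iC : Integrable (fun x ↦ 2 * (max (f x) 0 * Real.cosh ((x + y) / 2))) := i2'.const_mul 2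
  rw [integral_sub iB iC, integral_sub iA i2c, integral_add i1 i1',
    integral_const_mul, integral_const_mul] at hmain
  linarith [swu_primeSource_nonneg f a y]

end Source

/-! ## Cone density from the kernel hypotheses -/

section Cone

variable {a : ℝ}

/-- **Cone density from the parity-free kernel hypothesis** (`2cosh(s/2) ≤ w(s)` on `(0, 2a]`):
non-negative window tests are energy-dense among all normalised window tests at `a`; a test
matching an even `h` can be taken even. [folklore] -/
theorem swu_coneDense_of_kernel (ha : 0 < a)
    (hker : ∀ s : ℝ, 0 < s → s ≤ 2 * a → 2 * Real.cosh (s / 2) ≤ weilArchDensity s)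
    {h : ℝ → ℂ} (hh : IsWeilTest h) (hsupp : tsupport h ⊆ Icc (-a) a) (hnorm : ∫ t, ‖h t‖ ^ 2 = 1)
    {δ : ℝ} (hδ : 0 < δ) :
    ∃ w : ℝ → ℂ, IsWeilTest w ∧ tsupport w ⊆ Icc (-a) a ∧ (∀ t, (w t).im = 0 ∧ 0 ≤ (w t).re) ∧
      ∫ t, ‖w t‖ ^ 2 = 1 ∧ (weilQuadratic w).re ≤ (weilQuadratic h).re + δ ∧
      ((∀ t, h (-t) = h t) → ∀ t, w (-t) = w t) := by
  -- real case, Rayleigh form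
  have hreal : ∀ R : ℝ → ℝ, IsWeilTest (fun t ↦ ((R t : ℝ) : ℂ)) →
      tsupport (fun t ↦ ((R t : ℝ) : ℂ)) ⊆ Icc (-a) a → 0 < ∫ t, ‖((R t : ℝ) : ℂ)‖ ^ 2 → ∀ C : ℝ,
      (weilQuadratic fun t ↦ ((R t : ℝ) : ℂ)).re ≤ (∫ t, ‖((R t : ℝ) : ℂ)‖ ^ 2) * C →
        ∃ w : ℝ → ℂ, IsWeilTest w ∧ tsupport w ⊆ Icc (-a) a ∧ (∀ t, (w t).im = 0 ∧ 0 ≤ (w t).re) ∧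
          ∫ t, ‖w t‖ ^ 2 = 1 ∧ (weilQuadratic w).re ≤ C + δ ∧
          ((∀ t, R (-t) = R t) → ∀ t, w (-t) = w t) := by
    intro R hR hRs hN C hQ
    set N : ℝ := ∫ t, ‖((R t : ℝ) : ℂ)‖ ^ 2 with hNdef
    set c : ℝ := (Real.sqrt N)⁻¹ with hc
    have hcpos : 0 < c := inv_pos.2 (Real.sqrt_pos.2 hN)
    have hcc : c * c = 1 / N := by rw [hc, ← mul_inv, Real.mul_self_sqrt hN.le, one_div]
    have e : (fun t ↦ ((c * R t : ℝ) : ℂ)) = fun t ↦ (c : ℂ) * ((R t : ℝ) : ℂ) := by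
      funext t; push_cast; ring
    have hF1 : IsWeilTest fun t ↦ ((c * R t : ℝ) : ℂ) := by rw [e]; exact hR.const_mul c
    have hsupp1 : tsupport (fun t ↦ ((c * R t : ℝ) : ℂ)) ⊆ Icc (-a) a := by
      rw [e]; exact tsupport_mul_subset_right.trans hRs
    have e' : ∀ t, ((c * R t : ℝ) : ℂ) = (c : ℂ) * ((R t : ℝ) : ℂ) := fun t ↦ by push_cast; ring
    have hnorm1 : ∫ t, ‖((c * R t : ℝ) : ℂ)‖ ^ 2 = 1 := by
      have h1 : ∀ t, ‖((c * R t : ℝ) : ℂ)‖ ^ 2 = c ^ 2 * ‖((R t : ℝ) : ℂ)‖ ^ 2 := fun t ↦ by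
        rw [e', norm_mul, mul_pow, Complex.norm_real, Real.norm_of_nonneg hcpos.le]
      simp only [h1]
      rw [integral_const_mul, ← hNdef, hc, inv_pow, Real.sq_sqrt hN.le, inv_mul_cancel₀ hN.ne']
    have hQ1 : (weilQuadratic fun t ↦ ((c * R t : ℝ) : ℂ)).re ≤ C := by
      rw [e, weilQuadratic_const_mul, Complex.normSq_ofReal, Complex.re_ofReal_mul, hcc, one_div,
        inv_mul_eq_div, div_le_iff₀ hN]
      linarith
    have hgc := sw_contDiff_of_isWeilTest_ofReal hF1
    have hgcs := sw_hasCompactSupport_of_isWeilTest_ofReal hF1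
    have hgsR : tsupport (fun t ↦ c * R t) ⊆ Icc (-a) a := (sw_tsupport_ofReal_comp _) ▸ hsupp1
    have hsrc := fun y hy ↦ swu_source_nonneg_of_kernel hgc hgcs ha
      ((subset_tsupport _).trans hgsR) hker (y := y) hy
    obtain ⟨w, hw, hws, hsign, hwn, hwQ, hwe⟩ := swu_cone_of_source hgc hgcs ha hgsR hnorm1 hsrc hδ
    exact ⟨w, hw, hws, hsign, hwn, by linarith, fun hRe ↦ hwe fun t ↦ by rw [hRe]⟩
  -- complex case: select the real or the imaginary part
  have hR : IsWeilTest fun t ↦ (((h t).re : ℝ) : ℂ) := isWeilTest_rePart hh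
  have hS : IsWeilTest fun t ↦ (((h t).im : ℝ) : ℂ) := isWeilTest_imPart hh
  have hRs : tsupport (fun t ↦ (((h t).re : ℝ) : ℂ)) ⊆ Icc (-a) a :=
    (tsupport_rePart_subset h).trans hsupp
  have hSs : tsupport (fun t ↦ (((h t).im : ℝ) : ℂ)) ⊆ Icc (-a) a :=
    (tsupport_imPart_subset h).trans hsupp
  have hQ := re_weilQuadratic_eq_rePart_add_imPart hh
  have hNRS : (∫ t, ‖(((h t).re : ℝ) : ℂ)‖ ^ 2) + ∫ t, ‖(((h t).im : ℝ) : ℂ)‖ ^ 2 = 1 := by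
    rw [← hnorm]; exact integral_norm_sq_rePart_add_imPart hh.memLp_two
  have hNR0 : 0 ≤ ∫ t, ‖(((h t).re : ℝ) : ℂ)‖ ^ 2 := integral_nonneg fun t ↦ by positivity
  have hNS0 : 0 ≤ ∫ t, ‖(((h t).im : ℝ) : ℂ)‖ ^ 2 := integral_nonneg fun t ↦ by positivity
  have hx0 : (∫ t, ‖(((h t).re : ℝ) : ℂ)‖ ^ 2) = 0 →
      (weilQuadratic fun t ↦ (((h t).re : ℝ) : ℂ)).re = 0 := fun h0 ↦ by
    rw [hR.eq_zero_of_integral_norm_sq_eq_zero h0, weilQuadratic_zero, Complex.zero_re]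
  have hy0 : (∫ t, ‖(((h t).im : ℝ) : ℂ)‖ ^ 2) = 0 →
      (weilQuadratic fun t ↦ (((h t).im : ℝ) : ℂ)).re = 0 := fun h0 ↦ by
    rw [hS.eq_zero_of_integral_norm_sq_eq_zero h0, weilQuadratic_zero, Complex.zero_re]
  rcases sw_select hNR0 hNS0 hNRS hQ.symm hx0 hy0 with ⟨hN, hle⟩ | ⟨hN, hle⟩
  · obtain ⟨w, hw, hws, hsign, hwn, hwQ, hwe⟩ := hreal _ hR hRs hN _ hle
    exact ⟨w, hw, hws, hsign, hwn, hwQ, fun hhe ↦ hwe fun t ↦ by rw [hhe]⟩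
  · obtain ⟨w, hw, hws, hsign, hwn, hwQ, hwe⟩ := hreal _ hS hSs hN _ hle
    exact ⟨w, hw, hws, hsign, hwn, hwQ, fun hhe ↦ hwe fun t ↦ by rw [hhe]⟩

/-- **The S1 matrix from the even kernel hypothesis** (`2cosh(s/2)+2cosh(t/2) ≤ w(s)+w(t)` on
`s + t ≤ 2a`): even cone tests are dense among even normalised window tests at `a`. [folklore] -/
theorem swu_evenConeDense_of_kernel_even (ha : 0 < a)
    (hker : ∀ s t : ℝ, 0 < s → 0 < t → s + t ≤ 2 * a →
      2 * Real.cosh (s / 2) + 2 * Real.cosh (t / 2) ≤ weilArchDensity s + weilArchDensity t) :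
    ∀ h : ℝ → ℂ, IsWeilTest h → tsupport h ⊆ Set.Icc (-a) a → (∀ t, h (-t) = h t) →
      ∫ t, ‖h t‖ ^ 2 = (1 : ℝ) → ∀ δ : ℝ, 0 < δ →
        ∃ w : ℝ → ℂ, IsWeilTest w ∧ tsupport w ⊆ Set.Icc (-a) a ∧ (∀ t, w (-t) = w t) ∧
          (∀ t, (w t).im = 0 ∧ 0 ≤ (w t).re) ∧ ∫ t, ‖w t‖ ^ 2 = (1 : ℝ) ∧
          (weilQuadratic w).re ≤ (weilQuadratic h).re + δ := by
  refine swu_evenConeDense_of_sourcePositive ha fun f hF hFs hfe hnorm δ hδ ↦ ?_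
  have hgc := sw_contDiff_of_isWeilTest_ofReal hF
  have hgcs := sw_hasCompactSupport_of_isWeilTest_ofReal hF
  have hgsR : tsupport f ⊆ Icc (-a) a := (sw_tsupport_ofReal_comp f) ▸ hFs
  refine ⟨f, hF, hFs, hfe, hnorm, by linarith, fun y hy ↦ ?_⟩
  exact swu_source_nonneg_of_kernel_even hgc hgcs ha ((subset_tsupport _).trans hgsR) hfe hker hy

end Cone

end Summit.RiemannHypothesis.RiemannHypothesis.Theorems.PolarPerronFrobenius

end
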